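import Literature.Probability.LatticeModels.MeanFieldBound
import Literature.Probability.LatticeModels.IsingPeierls
import Literature.Probability.LatticeModels.FieldCurrents
import HarnessLib

/-!
# The mean-field lower bound: from Duminil-Copin–Tassion's Lemmas 2.6–2.7 to crit-ising.S08

Sibling proof file of `Literature.Probability.LatticeModels.MeanFieldBound` (the supercritical
half of the Duminil-Copin–Tassion route to `Literature.Probability.LatticeModels.meanField_lower_bound`, crit-ising.S08).
This file

* **Part B** — proves the plus-state §2.5 fact `dct_twoPointPlus_exponentialDecay` of
  `MeanFieldBound` from DCT's **Lemma 2.7** (the *modified Simon inequality*, stated by the source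
  for the plus state `⟨·⟩⁺_β = lim_{h↘0}⟨·⟩_{β,h}` and vendored here as the named fact
  `dct_modifiedSimon`), by the printed `⌊n/L⌋`-fold iteration
  (`twoPointPlus_le_dctIsingPhi_pow`, `dct_twoPointPlus_exponentialDecay_of_modifiedSimon`), using
  the translation invariance of `⟨σ_xσ_y⟩⁺` (tree theorem `PlusStateFKG.plusPair_eq_twoPointPlus_sub`)
  and GKS I (`gks_one_holds`);
* **assembles**: `meanField_lower_bound_of_facts` — crit-ising.S08 from DCT's eq. (2.6)
  (`SharpnessSubcritical.dct_magnetization_lower_bound`, the §2.4 residue: DCT's Lemma 2.6 with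
  the boundary correction of CMP 359 (2018) 821, integrated, `Λ ↑ ℤ^d`, `h ↘ 0`), DCT Lemma 2.7
  for the plus state, and Peierls' theorem; and, Peierls being the tree theorem
  `exists_spontaneousMagnetization_pos_holds` (`IsingPeierls`),
  `meanField_lower_bound_of_dct_eq26_lemma27` — **crit-ising.S08 follows from DCT's eq. (2.6) and
  DCT's Lemma 2.7 for the plus state**, everything else being theorems of the tree.

The tree's `ModifiedSimonInequality` proves Lemma 2.7 in finite volume at zero field (free
boundary condition), whence the decay of the *free* two-point function (`SharpnessSubcritical`);
the plus-state form needed here is the `h ↘ 0` limit of the positive-field version of the same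
display (arXiv:1502.03050, p. 11–12), not yet in the tree. The other hypothesis `hmag`
(DCT eq. (2.6), `SharpnessSubcritical.dct_magnetization_lower_bound`) is decomposed and reduced
to named facts (DCT Lemma 2.6 with the 2018 boundary correction, the vanishing of the boundary
term, GHS concavity, `lim_{h↘0}⟨σ₀⟩_{β,h} = m*`) in the tree's `MeanFieldLowerBound`
(`dct_magnetization_lower_bound_of_facts`), so that the two halves compose.

## References

* H. Duminil-Copin, V. Tassion, Comm. Math. Phys. **343** (2016) 725–745, §2 (arXiv:1502.03050):
  Lemma 2.7 and the end of §2.5.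
* S. Friedli, Y. Velenik, *Statistical Mechanics of Lattice Systems* (CUP 2017), Thm. 3.17.
-/

noncomputable section

open MeasureTheory Filter Topology Finset Literature.Probability.LatticeModels Literature.Probability.Percolation

namespace Literature.Probability.LatticeModels

variable {d : ℕ}

/-! ## Part B. Exponential decay below `β̃_c` from the modified Simon inequality (DCT §2.5) -/

/-- **Duminil-Copin–Tassion 2016, Lemma 2.7 (modified Simon's inequality)**, for the
nearest-neighbour Ising model on `ℤ^d` (arXiv:1502.03050, §2.5: "Let `S` be a finite subset of
`V` containing `0`. For every `z ∈ V ∖ S`,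
`⟨σ₀σ_z⟩⁺_β ≤ ∑_{x∈S} ∑_{y∉S} tanh(β J_{x,y}) ⟨σ₀σ_x⟩_{S,β,0} ⟨σ_yσ_z⟩⁺_β`", `β > 0` the standing
assumption of §2). With `J_{x,y} = 1_{x∼y}` the inner sum runs over the neighbours `y ∼ x`
outside `S`; `⟨σ₀σ_x⟩_{S,β,0}` is the free-boundary zero-field two-point function in the finite
volume `S` (`isingTwoPoint (zdGraph d) S β 0 .free 0 x`), and DCT's `⟨σ_yσ_z⟩⁺_β` (the `h ↘ 0`
limit of the infinite-volume limits of the free measures with field `h > 0`) is the plus state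
at zero field, the tree's `plusPair d β y z = ⟨σ_yσ_z⟩⁺_{β,0}` (Friedli–Velenik 2017, Thm. 3.46
(uniqueness for `h ≠ 0`, so `lim_Λ ⟨·⟩^∅_{Λ;β,h} = ⟨·⟩⁺_{β,h}`), and Exercise 3.31 (monotonicity of
`h ↦ ⟨σ_A⟩⁺_{Λ;β,h}`) with the double monotone limit of the proof of Lemma 3.31 (1), giving
`lim_{h↓0}⟨σ_A⟩⁺_{β,h} = ⟨σ_A⟩⁺_{β,0}`; for `σ₀` alone this is Prop. 3.29 / Remark 3.30). The
printed proof uses the backbone representation of random currents with a ghost vertex (§2.3,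
P1–P3): the finite-volume display with field `h ≥ 0` (p. 11), then `Λ ↑ V` and `h ↘ 0` (p. 12);
the tree's `ModifiedSimonInequality` proves that display at `h = 0` (free boundary condition),
which yields the *free*-state version only. [cite: DuminilCopinTassionCMP2016, Lemma 2.7 (arXiv:1502.03050 numbering; modified Simon's inequality)] -/
def dct_modifiedSimon : Prop :=
  ∀ ⦃β : ℝ⦄, 0 < β → ∀ S : Finset (Site d), (0 : Site d) ∈ S → ∀ z ∉ S,
    plusPair d β 0 z ≤ ∑ x ∈ S, ∑ y ∈ ((zdGraph d).neighborFinset x).filter (fun y => y ∉ S),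
      Real.tanh β * isingTwoPoint (zdGraph d) S β 0 .free 0 x * plusPair d β y z

/-- **The iteration of Duminil-Copin–Tassion 2016, §2.5** (arXiv:1502.03050, p. 12: "Lemma 2.7
implies that for any `z` with `d(0,z) ≥ n > L`, `⟨σ₀σ_z⟩⁺ ≤ φ_β(S) max_{y ∈ Λ_L}⟨σ_yσ_z⟩⁺` … The
proof follows by iterating `⌊n/L⌋` times this strategy"), in the sup norm: granting Lemma 2.7
(and using the tree theorems: translation invariance of `⟨σσ⟩⁺`, `0 ≤ ⟨σ₀σ_x⟩⁺ ≤ 1` from the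
existence of the plus state and GKS I), if `S ∋ 0` with `‖x‖_∞ ≤ L - 1` on `S` then
`⟨σ₀σ_v⟩⁺_β ≤ φ_β(S)^k` whenever `‖v‖_∞ > k L`. [cite: DuminilCopinTassionCMP2016, §2.5, end of the proof of Thm. 2.1 (iteration)] -/
theorem twoPointPlus_le_dctIsingPhi_pow (h27 : dct_modifiedSimon (d := d))
    {β : ℝ} (hβ : 0 < β) {S : Finset (Site d)} (h0 : (0 : Site d) ∈ S) {L : ℕ}
    (hSL : ∀ x ∈ S, Site.supNorm x + 1 ≤ L) :
    ∀ (k : ℕ) (v : Site d), k * L < Site.supNorm v → twoPointPlus d β v ≤ dctIsingPhi d β S ^ k := by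
  intro k
  induction k with
  | zero =>
    intro v _
    rw [pow_zero]
    exact twoPointPlus_le_one hasBoxLimit_isingCorr_plus_holds hβ.le v
  | succ k ih =>
    intro v hv
    have hvS : v ∉ S := fun hvS => by
      have := hSL v hvS
      nlinarith
    have hstep := h27 hβ S h0 v hvS
    rw [plusPair_zero_left] at hstep
    refine hstep.trans ?_
    -- each `⟨σ_yσ_v⟩⁺ = ⟨σ₀σ_{v-y}⟩⁺ ≤ φ^k` since `‖v - y‖_∞ > k L`
    have hbound : ∀ x ∈ S, ∀ y ∈ ((zdGraph d).neighborFinset x).filter (fun y => y ∉ S),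
        Real.tanh β * isingTwoPoint (zdGraph d) S β 0 .free 0 x * plusPair d β y v ≤
          Real.tanh β * isingTwoPoint (zdGraph d) S β 0 .free 0 x * dctIsingPhi d β S ^ k := by
      intro x hx y hy
      refine mul_le_mul_of_nonneg_left ?_
        (mul_nonneg (tanh_nonneg hβ.le) (isingTwoPoint_free_nonneg
          (fun {_ _ _ _ _} => Literature.Probability.LatticeModels.GriffithsKellySherman.gks_one_holds (zdGraph d)) hβ.le h0 hx))
      rw [plusPair_eq_twoPointPlus_sub hβ.le y v]
      refine ih (v - y) ?_
      have hyx : (zdGraph d).Adj x y := by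
        have := (mem_filter.1 hy).1
        simpa using this
      have hy1 : Site.supNorm y ≤ L := (Site.supNorm_le_succ_of_adj hyx).trans (hSL x hx)
      have htri : Site.supNorm v ≤ Site.supNorm (v - y) + Site.supNorm y := by
        simpa using Site.supNorm_add_le (v - y) y
      have : (k + 1) * L = k * L + L := by ring
      omega
    calc ∑ x ∈ S, ∑ y ∈ ((zdGraph d).neighborFinset x).filter (fun y => y ∉ S),
          Real.tanh β * isingTwoPoint (zdGraph d) S β 0 .free 0 x * plusPair d β y v
        ≤ ∑ x ∈ S, ∑ y ∈ ((zdGraph d).neighborFinset x).filter (fun y => y ∉ S),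
          Real.tanh β * isingTwoPoint (zdGraph d) S β 0 .free 0 x * dctIsingPhi d β S ^ k :=
          sum_le_sum fun x hx => sum_le_sum fun y hy => hbound x hx y hy
      _ = (∑ x ∈ S, ∑ _y ∈ ((zdGraph d).neighborFinset x).filter (fun y => y ∉ S),
            Real.tanh β * isingTwoPoint (zdGraph d) S β 0 .free 0 x) * dctIsingPhi d β S ^ k := by
          simp_rw [Finset.sum_mul]
      _ = dctIsingPhi d β S ^ (k + 1) := by
          rw [pow_succ']
          rfl

/-- **Duminil-Copin–Tassion 2016, Thm. 2.1, third item with `β̃_c` (§2.5), from Lemma 2.7**: for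
the nearest-neighbour model on `ℤ^d`, `d ≥ 1`, `β > 0` and a finite `S ∋ 0` with `φ_β(S) < 1`,
`⟨σ₀σ_x⟩⁺_β ≤ C e^{-c‖x‖}` for all `x`, with `c > 0`. From `twoPointPlus_le_dctIsingPhi_pow` with
`L = 1 + max_S ‖·‖_∞` and `k = ⌊(‖x‖_∞ - 1)/L⌋ ≥ ‖x‖_∞/L - 1`: writing `ψ = max(φ_β(S), 1/2) < 1`,
`⟨σ₀σ_x⟩⁺ ≤ ψ^k ≤ ψ⁻¹ e^{-(-log ψ / L)‖x‖}`. This discharges `dct_twoPointPlus_exponentialDecay`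
relative to Lemma 2.7 (plus state) alone. [cite: DuminilCopinTassionCMP2016, §2.5, proof of Thm. 2.1 item 3 (arXiv numbering)] -/
theorem dct_twoPointPlus_exponentialDecay_of_modifiedSimon (h27 : dct_modifiedSimon (d := d)) :
    dct_twoPointPlus_exponentialDecay (d := d) := by
  intro _hd β hβ S h0 hφ
  set φ := dctIsingPhi d β S with hφdef
  have hφ0 : 0 ≤ φ := dctIsingPhi_nonneg (fun {_ _ _ _ _} => Literature.Probability.LatticeModels.GriffithsKellySherman.gks_one_holds (zdGraph d)) hβ.le h0
  -- the scale `L`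
  set L : ℕ := S.sup Site.supNorm + 1 with hL
  have hSL : ∀ x ∈ S, Site.supNorm x + 1 ≤ L := fun x hx =>
    Nat.add_le_add_right (Finset.le_sup (f := Site.supNorm) hx) 1
  have hL1 : (1 : ℝ) ≤ L := by simp [hL]
  have hLpos : (0 : ℝ) < L := by linarith
  -- `ψ = max φ (1/2) ∈ [1/2, 1)`
  set ψ : ℝ := max φ (1 / 2) with hψ
  have hψpos : 0 < ψ := lt_max_of_lt_right one_half_pos
  have hψ1 : ψ < 1 := max_lt hφ one_half_lt_one
  have hlogψ : Real.log ψ < 0 := Real.log_neg hψpos hψ1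
  refine ⟨-Real.log ψ / L, div_pos (neg_pos.2 hlogψ) hLpos, ψ⁻¹, fun x => ?_⟩
  -- `⟨σ₀σ_x⟩⁺ ≤ φ^k ≤ ψ^k` with `k = ⌊(‖x‖_∞ - 1)/L⌋`
  set N : ℕ := Site.supNorm x with hN
  set k : ℕ := (N - 1) / L with hk
  have hpow : twoPointPlus d β x ≤ φ ^ k := by
    rcases Nat.eq_zero_or_pos N with hN0 | hNpos
    · have hk0 : k = 0 := by simp [hk, hN0]
      rw [hk0, pow_zero]
      exact twoPointPlus_le_one hasBoxLimit_isingCorr_plus_holds hβ.le x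
    · refine twoPointPlus_le_dctIsingPhi_pow h27 hβ h0 hSL k x ?_
      have h1 : k * L ≤ N - 1 := Nat.div_mul_le_self (N - 1) L
      omega
  have hψk : φ ^ k ≤ ψ ^ k := pow_le_pow_left₀ hφ0 (le_max_left _ _) k
  -- `k ≥ N/L - 1` as reals
  have hkreal : (N : ℝ) / L - 1 ≤ k := by
    have hLnat : 0 < L := by simp [hL]
    have hdm : (L : ℝ) * k + (((N - 1) % L : ℕ) : ℝ) = ((N - 1 : ℕ) : ℝ) := by
      rw [hk]
      exact_mod_cast Nat.div_add_mod (N - 1) L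
    have hml : (((N - 1) % L : ℕ) : ℝ) + 1 ≤ L := by
      exact_mod_cast Nat.succ_le_of_lt (Nat.mod_lt (N - 1) hLnat)
    have h2 : (N : ℝ) - 1 ≤ ((N - 1 : ℕ) : ℝ) := by
      rcases Nat.eq_zero_or_pos N with h | h
      · simp [h]
      · rw [Nat.cast_sub h]; simp
    rw [div_sub_one hLpos.ne', div_le_iff₀ hLpos]
    linarith
  -- `ψ^k = exp(k log ψ) ≤ exp((N/L - 1) log ψ) = ψ⁻¹ exp(-c N)`
  have hexp : ψ ^ k ≤ ψ⁻¹ * Real.exp (-(-Real.log ψ / L) * ‖x‖) := by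
    rw [Site.norm_eq_supNorm, ← hN]
    have e1 : ψ ^ k = Real.exp (k * Real.log ψ) := by
      rw [Real.exp_nat_mul, Real.exp_log hψpos]
    have e2 : ψ⁻¹ * Real.exp (-(-Real.log ψ / L) * (N : ℝ)) =
        Real.exp (((N : ℝ) / L - 1) * Real.log ψ) := by
      rw [← Real.exp_log hψpos, ← Real.exp_neg, ← Real.exp_add, Real.log_exp]
      congr 1
      field_simp
      ring
    rw [e1, e2]
    exact Real.exp_le_exp.2 (by nlinarith)
  exact hpow.trans (hψk.trans hexp)


/-! ## Assembly -/

/-- **crit-ising.S08 (mean-field lower bound `m*(β) ≥ c (β - β_c)^{1/2}`) from DCT's eq. (2.6),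
DCT's Lemma 2.7 for the plus state, and Peierls' theorem only**:
`MeanFieldBound.meanField_lower_bound_of_dct_facts` fed with
`dct_twoPointPlus_exponentialDecay_of_modifiedSimon` (§2.5 from Lemma 2.7). What remains
hypothetical: DCT eq. (2.6) (`SharpnessSubcritical.dct_magnetization_lower_bound`: Lemma 2.6 —
with the boundary correction of CMP 359 (2018) 821 — integrated between `β̃_c` and `β`,
`Λ ↑ ℤ^d`, `h ↘ 0`), DCT Lemma 2.7 for the plus state (`dct_modifiedSimon`: the positive-field
modified Simon inequality, `h ↘ 0`), and Peierls' theorem (`exists_spontaneousMagnetization_pos`: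
some `β` with `m*(β) > 0` in `d ≥ 2`, used only for `β̃_c < ∞`). (Duminil-Copin–Tassion, CMP 343
(2016), Thm. 1.2; Aizenman–Barsky–Fernández, J. Stat. Phys. 47 (1987), Thm. 1 (ii).) [cite: DuminilCopinTassionCMP2016, Thm. 1.2 (arXiv: Thm. 2.1, first item), §2.4 eq. (2.6) and Lemma 2.7] -/
theorem meanField_lower_bound_of_facts
    (hmag : dct_magnetization_lower_bound (d := d))
    (h27 : dct_modifiedSimon (d := d))
    (hpeierls : exists_spontaneousMagnetization_pos (d := d)) :
    meanField_lower_bound (d := d) :=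
  meanField_lower_bound_of_dct_facts hmag (dct_twoPointPlus_exponentialDecay_of_modifiedSimon h27)
    hpeierls

/-- **crit-ising.S08 from the two remaining Duminil-Copin–Tassion facts only**: Peierls'
theorem is the tree theorem `exists_spontaneousMagnetization_pos_holds` (`IsingPeierls`), so
`meanField_lower_bound` holds granting DCT eq. (2.6) (`SharpnessSubcritical.dct_magnetization_lower_bound`,
itself reduced to the corrected Lemma 2.6, the vanishing of its boundary term, GHS concavity and
`lim_{h↘0}⟨σ₀⟩_{β,h} = m*` in `MeanFieldLowerBound`) and DCT Lemma 2.7 for the plus state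
(`dct_modifiedSimon`). [cite: DuminilCopinTassionCMP2016, Thm. 1.2 (arXiv: Thm. 2.1, first item), §2.4 eq. (2.6) and Lemma 2.7] -/
theorem meanField_lower_bound_of_dct_eq26_lemma27
    (hmag : dct_magnetization_lower_bound (d := d)) (h27 : dct_modifiedSimon (d := d)) :
    meanField_lower_bound (d := d) :=
  meanField_lower_bound_of_facts hmag h27 exists_spontaneousMagnetization_pos_holds

end Literature.Probability.LatticeModels


/-! ## Appendix (discharge of `dct_modifiedSimon`): Lemma 2.7 for the plus state, proved

Duminil-Copin–Tassion prove Lemma 2.7 (arXiv:1502.03050, pp. 19–20) in finite volume with a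
field `h ≥ 0` through the backbone representation with a ghost vertex, then let `Λ ↑ V` and
`h ↘ 0`, their `⟨·⟩⁺_β` being `lim_{h↘0} lim_{Λ↑V} ⟨·⟩_{Λ,β,h}`. The tree's plus state
`plusPair d β y z = ⟨σ_yσ_z⟩⁺_{β,0}` is instead the box limit of the finite-volume `+` states at
zero field (`MagnetizationContinuity.plusPair`, `tendsto_isingExpect_plus_spinPair`), so we prove
the finite-volume inequality directly for the **`+` boundary condition at `h = 0`** and let the
box grow; no `h ↘ 0` limit is needed. The `+` boundary condition of `Λ` is realised, exactly, as
the free model on the ghost graph `Λ ∪ {g}` of `FieldCurrents` with edge-dependent couplings: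
`β` on the edges of `G` inside `Λ` and `β · #{y ∼ x : y ∉ Λ}` on the ghost edge at `x` (the bonds
to the frozen `+` spins are a boundary field; Friedli–Velenik 2017, §3.8.1;
Aizenman–Duminil-Copin–Sidoravicius 2015, eq. (2.8)), the ghost spin being `+1`, which is
harmless for the even observables `σ_aσ_z`.

1. `tsum_exit_edge_le_theta`, `gcurrentZ_mul_gcurrentZ_le` — the random-current heart of
   Lemma 2.7 (first exit from `S`, switching lemma, `tanh` factor of the exit edge) for currents
   with edge-dependent couplings `θ ≥ 0` (`FieldCurrents.gweight`/`gcurrentZ`), verbatim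
   generalisations of `ModifiedSimonInequality.tsum_exit_edge_le`/`currentZ_mul_currentZ_le`.
2. `isingCorr_plus_eq_gcurrentZ_div` — the random-current representation
   `⟨σ_A⟩⁺_{Λ;β,0} = Z_{ℰ⁺_Λ}(A*)/Z_{ℰ⁺_Λ}(∅)` on the ghost graph (high-temperature expansion as in
   `FieldCurrents.isingCorr_free_eq_gcurrentZ_div`).
3. `isingTwoPoint_plus_le_modifiedSimon` — for every locally finite graph, `β ≥ 0`, `S ⊆ Λ` with
   all neighbours of `S` inside `Λ`, `a ∈ S`, `z ∈ Λ ∖ S`: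
   `⟨σ_aσ_z⟩⁺_{Λ;β,0} ≤ ∑_{x∈S} ∑_{y∈Λ∖S, y∼x} tanh β ⟨σ_aσ_x⟩^∅_{S;β,0} ⟨σ_yσ_z⟩⁺_{Λ;β,0}`
   (the exit through the ghost edge at `x ∈ S` costs `tanh(β · 0) = 0`).
4. `dct_modifiedSimon_holds` — `Λ = Λ_L ↑ ℤ^d`.
-/

open scoped symmDiff ENNReal

namespace Literature.Probability.LatticeModels

variable {V : Type*} [DecidableEq V]

section ThetaSimon

variable {G : SimpleGraph V} [G.LocallyFinite] {Λ : Finset V}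

/-- **The `tanh` bound for one edge, edge-dependent couplings.** For an edge `e₀ = {x, y} ∈ ℰ_Λ`
and couplings `θ ≥ 0`, `∑_{∂n = {x} ∆ {z}, n_{e₀} > 0} w_θ(n) ≤ tanh θ_{e₀} · ∑_{∂n = {y} ∆ {z}} w_θ(n)`:
conditioning on the current off `e₀`, this is `cosh θ_{e₀} - 1 ≤ tanh θ_{e₀} sinh θ_{e₀}` and
`sinh θ_{e₀} = tanh θ_{e₀} cosh θ_{e₀}` (the factor `⟨σ_xσ_y⟩_{{x,y},β,h} → tanh(βJ_{x,y})` of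
Duminil-Copin–Tassion 2016, proof of Lemma 2.7; the tree's `tsum_exit_edge_le` is the case of a
constant coupling). [cite: DuminilCopinTassionCMP2016, proof of Lemma 2.7 (arXiv:1502.03050 numbering)] -/
theorem tsum_exit_edge_le_theta {θ : Sym2 V → ℝ} (hθ : ∀ e, 0 ≤ θ e) {x y : V} (z : V)
    (e₀ : edgesIn G Λ) (he₀ : (e₀ : Sym2 V) = s(x, y)) :
    ∑' n, ind (csources G Λ n = {x} ∆ {z} ∧ 0 < n e₀) * gweight G Λ θ n ≤
      ENNReal.ofReal (Real.tanh (θ e₀)) *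
        ∑' n, ind (csources G Λ n = {y} ∆ {z}) * gweight G Λ θ n := by
  have hxy : x ≠ y := by
    have := (mem_edgesIn_iff.1 (he₀ ▸ e₀.2)).1
    exact G.ne_of_adj ((SimpleGraph.mem_edgeSet G).1 this)
  have hT : Λ.filter (· ∈ (e₀ : Sym2 V)) = {y} ∆ {x} := by
    rw [he₀, filter_mem_edge_eq (he₀ ▸ e₀.2), pair_eq_symmDiff hxy]
  have hθ₀ : 0 ≤ θ e₀ := hθ _
  set t : ℝ := θ e₀ with ht
  set R : Finset V → ℝ≥0∞ := fun B => ∑' n : edgesIn G Λ → ℕ,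
    if n e₀ = 0 then ind (csources G Λ n = B) * gweight G Λ θ n else 0 with hR
  -- left-hand side
  have hL : ∑' n, ind (csources G Λ n = {x} ∆ {z} ∧ 0 < n e₀) * gweight G Λ θ n =
      (∑' k, edgeWeight t k * ind (0 < k ∧ Even k)) * R ({x} ∆ {z}) +
        (∑' k, edgeWeight t k * ind (Odd k)) * R ({y} ∆ {z}) := by
    rw [tsum_pi_nat_split e₀, ← ENNReal.tsum_mul_right, ← ENNReal.tsum_mul_right,
      ← ENNReal.tsum_add]
    refine tsum_congr fun k => ?_
    rw [hR]
    simp only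
    rw [← ENNReal.tsum_mul_left, ← ENNReal.tsum_mul_left, ← ENNReal.tsum_add]
    refine tsum_congr fun n => ?_
    by_cases hn : n e₀ = 0
    · rw [if_pos hn, if_pos hn, if_pos hn, Function.update_self, csources_update hn,
        gweight_update hn θ k, hT]
      rcases Nat.even_or_odd k with hke | hko
      · have h3 : ind (Odd k) = 0 := ind_of_false (Nat.not_odd_iff_even.2 hke)
        rw [if_neg (Nat.not_odd_iff_even.2 hke), h3]
        rcases Nat.eq_zero_or_pos k with rfl | hk
        · have h1 : ind (csources G Λ n = {x} ∆ {z} ∧ 0 < 0) = 0 :=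
            ind_of_false fun h => lt_irrefl 0 h.2
          have h2 : ind (0 < 0 ∧ Even 0) = 0 := ind_of_false fun h => lt_irrefl 0 h.1
          rw [h1, h2]
          ring
        · have h1 : ind (csources G Λ n = {x} ∆ {z} ∧ 0 < k) = ind (csources G Λ n = {x} ∆ {z}) :=
            ind_congr ⟨fun h => h.1, fun h => ⟨h, hk⟩⟩
          have h2 : ind (0 < k ∧ Even k) = 1 := ind_of_true ⟨hk, hke⟩
          rw [h1, h2]
          ring
      · have h1 : ind (csources G Λ n ∆ ({y} ∆ {x}) = {x} ∆ {z} ∧ 0 < k) =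
            ind (csources G Λ n = {y} ∆ {z}) := by
          refine ind_congr ⟨fun h => ?_, fun h => ⟨?_, hko.pos⟩⟩
          · rw [← symmDiff_pair_pair x y z, ← h.1, symmDiff_symmDiff_cancel_right]
          · rw [h, ← symmDiff_pair_pair x y z, symmDiff_symmDiff_cancel_right]
        have h2 : ind (0 < k ∧ Even k) = 0 := ind_of_false fun h => (Nat.not_even_iff_odd.2 hko) h.2
        have h3 : ind (Odd k) = 1 := ind_of_true hko
        rw [if_pos hko, h1, h2, h3]
        ring
    · rw [if_neg hn, if_neg hn, if_neg hn, mul_zero, mul_zero, add_zero]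
  -- right-hand side
  have hRt : ∑' n, ind (csources G Λ n = {y} ∆ {z}) * gweight G Λ θ n =
      (∑' k, edgeWeight t k * ind (Even k)) * R ({y} ∆ {z}) +
        (∑' k, edgeWeight t k * ind (Odd k)) * R ({x} ∆ {z}) := by
    rw [tsum_pi_nat_split e₀, ← ENNReal.tsum_mul_right, ← ENNReal.tsum_mul_right,
      ← ENNReal.tsum_add]
    refine tsum_congr fun k => ?_
    rw [hR]
    simp only
    rw [← ENNReal.tsum_mul_left, ← ENNReal.tsum_mul_left, ← ENNReal.tsum_add]
    refine tsum_congr fun n => ?_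
    by_cases hn : n e₀ = 0
    · rw [if_pos hn, if_pos hn, if_pos hn, csources_update hn, gweight_update hn θ k, hT]
      rcases Nat.even_or_odd k with hke | hko
      · have h2 : ind (Even k) = 1 := ind_of_true hke
        have h3 : ind (Odd k) = 0 := ind_of_false (Nat.not_odd_iff_even.2 hke)
        rw [if_neg (Nat.not_odd_iff_even.2 hke), h2, h3]
        ring
      · have hid : (({y} ∆ {z}) ∆ ({y} ∆ {x}) : Finset V) = {x} ∆ {z} := by
          rw [symmDiff_symmDiff_symmDiff_comm, symmDiff_self, bot_symmDiff, symmDiff_comm]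
        have h1 : ind (csources G Λ n ∆ ({y} ∆ {x}) = {y} ∆ {z}) = ind (csources G Λ n = {x} ∆ {z}) := by
          refine ind_congr ⟨fun h => ?_, fun h => ?_⟩
          · rw [← hid, ← h, symmDiff_symmDiff_cancel_right]
          · rw [h, ← hid, symmDiff_symmDiff_cancel_right]
        have h2 : ind (Even k) = 0 := ind_of_false (Nat.not_even_iff_odd.2 hko)
        have h3 : ind (Odd k) = 1 := ind_of_true hko
        rw [if_pos hko, h1, h2, h3]
        ring
    · rw [if_neg hn, if_neg hn, if_neg hn, mul_zero, mul_zero, add_zero]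
  rw [hL, hRt, mul_add, tsum_edgeWeight_odd_eq hθ₀, tsum_edgeWeight_even_eq_ofReal hθ₀]
  rw [add_comm]
  refine add_le_add (le_of_eq ?_) ?_
  · ring
  · calc (∑' k, edgeWeight t k * ind (0 < k ∧ Even k)) * R ({x} ∆ {z})
        ≤ (ENNReal.ofReal (Real.tanh t) * ENNReal.ofReal (Real.sinh t)) * R ({x} ∆ {z}) :=
          mul_le_mul_left (tsum_edgeWeight_pos_even_le hθ₀) _
      _ = _ := by
          rw [show ENNReal.ofReal (Real.sinh t) =
            ENNReal.ofReal (Real.tanh t) * ENNReal.ofReal (Real.cosh t) from by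
              rw [← ENNReal.ofReal_mul (by
                rw [Real.tanh_eq_sinh_div_cosh]
                exact div_nonneg (Real.sinh_nonneg_iff.2 hθ₀) (Real.cosh_pos t).le),
                Real.tanh_eq_sinh_div_cosh, div_mul_cancel₀ _ (Real.cosh_pos t).ne']]
          ring

variable (G Λ) [DecidableRel G.Adj] in
/-- **The modified Simon inequality for current sums, edge-dependent couplings** (the
random-current heart of Duminil-Copin–Tassion 2016, Lemma 2.7, for currents with couplings
`θ_e ≥ 0`, proved by the switching lemma): for `S ⊆ Λ`, `a ∈ S`, `z ∉ S`,
`Z_Λ({a,z}) Z_S(∅) ≤ ∑_{x ∈ S} ∑_{y ∈ Λ∖S, y ∼ x} tanh θ_{xy} · Z_Λ({y,z}) Z_S({a,x})`.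
A current on `Λ` with sources `{a, z}` connects `a` to `z`, hence leaves `S` through a charged
edge `{x, y}` after connecting `a` to `x` inside `S`; switching the sources `{a, x}` into the
sourceless current on `S` and removing the parity constraint on the exit edge costs `tanh θ_{xy}`
(the tree's `currentZ_mul_currentZ_le` is the constant-coupling case). [cite: DuminilCopinTassionCMP2016, Lemma 2.7 and its proof, §2.5 (arXiv:1502.03050 numbering)] -/
theorem gcurrentZ_mul_gcurrentZ_le {θ : Sym2 V → ℝ} (hθ : ∀ e, 0 ≤ θ e) {S : Finset V}
    (hS : S ⊆ Λ) {a z : V} (ha : a ∈ S) (hzS : z ∉ S) :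
    gcurrentZ G Λ θ (edgesIn G Λ) ({a} ∆ {z}) * gcurrentZ G Λ θ (edgesIn G S) ∅ ≤
      ∑ x ∈ S, ∑ y ∈ (Λ \ S).filter (G.Adj x),
        ENNReal.ofReal (Real.tanh (θ s(x, y))) * gcurrentZ G Λ θ (edgesIn G Λ) ({y} ∆ {z}) *
          gcurrentZ G Λ θ (edgesIn G S) ({a} ∆ {x}) := by
  set w : (edgesIn G Λ → ℕ) → ℝ≥0∞ := gweight G Λ θ with hw
  have haz : a ≠ z := fun h => hzS (h ▸ ha)
  have hZΛ : ∀ A, gcurrentZ G Λ θ (edgesIn G Λ) A = ∑' n, ind (csources G Λ n = A) * w n :=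
    fun A => tsum_congr fun n => by
      rw [ind_congr ⟨fun h => h.1, fun h => ⟨h, csupp_edgesIn n⟩⟩]
  have hsub : ∀ p : (edgesIn G Λ → ℕ) × (edgesIn G Λ → ℕ), p.1 + p.2 - p.2 = p.1 :=
    fun p => funext fun e => by simp
  -- the summand after the first-exit decomposition
  set Ψ : V → V → (edgesIn G Λ → ℕ) × (edgesIn G Λ → ℕ) → ℝ≥0∞ := fun x y p =>
    w p.1 * w p.2 * ind (csources G Λ p.1 = {a} ∆ {z} ∧
      (csources G Λ p.2 = ∅ ∧ CSupp G Λ (edgesIn G S) p.2) ∧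
      CConn G Λ (p.1 + p.2) (edgesIn G S) a x ∧
      ∃ e : edgesIn G Λ, (e : Sym2 V) = s(x, y) ∧ 0 < (p.1 + p.2) e) with hΨ
  -- Step 1: product of sums, first exit, exchange of sums
  have step1 : gcurrentZ G Λ θ (edgesIn G Λ) ({a} ∆ {z}) * gcurrentZ G Λ θ (edgesIn G S) ∅ ≤
      ∑ x ∈ S, ∑ y ∈ (Λ \ S).filter (G.Adj x), ∑' p, Ψ x y p := by
    rw [hZΛ, gcurrentZ, tsum_mul_tsum_eq_tsum_prod]
    calc ∑' p : (edgesIn G Λ → ℕ) × (edgesIn G Λ → ℕ),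
          ind (csources G Λ p.1 = {a} ∆ {z}) * w p.1 *
            (ind (csources G Λ p.2 = ∅ ∧ CSupp G Λ (edgesIn G S) p.2) * gweight G Λ θ p.2)
        ≤ ∑' p, ∑ x ∈ S, ∑ y ∈ (Λ \ S).filter (G.Adj x), Ψ x y p := by
          refine ENNReal.tsum_le_tsum fun p => ?_
          by_cases h1 : csources G Λ p.1 = {a} ∆ {z}
          · by_cases h2 : csources G Λ p.2 = ∅ ∧ CSupp G Λ (edgesIn G S) p.2
            · obtain ⟨x, hx, y, hy, hadj, ⟨e, hes, hpos⟩, hconn⟩ :=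
                exists_exit_edge (cconn_of_csources_eq haz h1) ha hzS
              have hy' : y ∈ (Λ \ S).filter (G.Adj x) := mem_filter.2 ⟨hy, hadj⟩
              have hΨ1 : Ψ x y p = w p.1 * w p.2 := by
                rw [hΨ]
                simp only
                rw [ind_of_true ⟨h1, h2, CConn.mono (fun e => Nat.le_add_right _ _) hconn,
                  e, hes, hpos.trans_le (Nat.le_add_right _ _)⟩, mul_one]
              calc ind (csources G Λ p.1 = {a} ∆ {z}) * w p.1 *
                    (ind (csources G Λ p.2 = ∅ ∧ CSupp G Λ (edgesIn G S) p.2) * gweight G Λ θ p.2)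
                  = Ψ x y p := by rw [hΨ1, ind_of_true h1, ind_of_true h2, one_mul, one_mul]
                _ ≤ ∑ y ∈ (Λ \ S).filter (G.Adj x), Ψ x y p :=
                    single_le_sum (f := fun y => Ψ x y p) (fun _ _ => zero_le) hy'
                _ ≤ ∑ x ∈ S, ∑ y ∈ (Λ \ S).filter (G.Adj x), Ψ x y p :=
                    single_le_sum (f := fun x => ∑ y ∈ (Λ \ S).filter (G.Adj x), Ψ x y p)
                      (fun _ _ => zero_le) hx
            · rw [ind_of_false h2, zero_mul, mul_zero]
              exact zero_le
          · rw [ind_of_false h1, zero_mul, zero_mul]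
            exact zero_le
      _ = ∑ x ∈ S, ∑ y ∈ (Λ \ S).filter (G.Adj x), ∑' p, Ψ x y p := by
          rw [Summable.tsum_finsetSum (fun _ _ => ENNReal.summable)]
          refine sum_congr rfl fun x _ => ?_
          rw [Summable.tsum_finsetSum (fun _ _ => ENNReal.summable)]
  refine step1.trans (sum_le_sum fun x hx => sum_le_sum fun y hy => ?_)
  -- Step 2: the pair `(x, y)`
  obtain ⟨hy, hadj⟩ := mem_filter.1 hy
  obtain ⟨hyΛ, hyS⟩ := mem_sdiff.1 hy
  have hxΛ : x ∈ Λ := hS hx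
  have he₀mem : s(x, y) ∈ edgesIn G Λ := by
    rw [mem_edgesIn_iff]
    refine ⟨(SimpleGraph.mem_edgeSet G).2 hadj, fun v hv => ?_⟩
    rcases Sym2.mem_iff.1 hv with rfl | rfl
    · exact hxΛ
    · exact hyΛ
  set e₀ : edgesIn G Λ := ⟨s(x, y), he₀mem⟩ with he₀
  have hnotS : (e₀ : Sym2 V) ∉ edgesIn G S := fun h =>
    hyS ((mem_edgesIn_iff.1 h).2 y (Sym2.mem_mk_right x y))
  -- the summands as functions of `(n₁ + n₂, n₂)`
  set Φ : (edgesIn G Λ → ℕ) → (edgesIn G Λ → ℕ) → ℝ≥0∞ := fun m n =>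
    ind (csources G Λ (m - n) = {a} ∆ {z} ∧ (csources G Λ n = ∅ ∧ CSupp G Λ (edgesIn G S) n) ∧
      CConn G Λ m (edgesIn G S) a x ∧ ∃ e : edgesIn G Λ, (e : Sym2 V) = s(x, y) ∧ 0 < m e) with hΦ
  set Φ' : (edgesIn G Λ → ℕ) → (edgesIn G Λ → ℕ) → ℝ≥0∞ := fun m n =>
    ind (csources G Λ (m - n) = {x} ∆ {z} ∧ (csources G Λ n = {a} ∆ {x} ∧ CSupp G Λ (edgesIn G S) n) ∧
      ∃ e : edgesIn G Λ, (e : Sym2 V) = s(x, y) ∧ 0 < m e) with hΦ'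
  -- switching, for a fixed multigraph `m`
  have inner : ∀ m : edgesIn G Λ → ℕ,
      ∑' n, cbinom G Λ m n * Φ m n ≤ ∑' n, cbinom G Λ m n * Φ' m n := by
    intro m
    by_cases hce : CConn G Λ m (edgesIn G S) a x ∧ ∃ e : edgesIn G Λ, (e : Sym2 V) = s(x, y) ∧ 0 < m e
    · have hL : ∑' n, cbinom G Λ m n * Φ m n =
          ∑' n, cbinom G Λ m n * ind (csources G Λ (m - n) = {a} ∆ {z} ∧
            (csources G Λ n = ∅ ∧ CSupp G Λ (edgesIn G S) n)) := by
        refine tsum_congr fun n => ?_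
        rw [hΦ]
        exact congrArg _ (ind_congr ⟨fun h => ⟨h.1, h.2.1⟩, fun h => ⟨h.1, h.2, hce⟩⟩)
      have hR : ∑' n, cbinom G Λ m n * ind (csources G Λ (m - n) = {x} ∆ {z} ∧
            (csources G Λ n = {a} ∆ {x} ∧ CSupp G Λ (edgesIn G S) n)) ≤
          ∑' n, cbinom G Λ m n * Φ' m n := by
        refine ENNReal.tsum_le_tsum fun n => mul_le_mul_right (ind_mono fun h => ?_) _
        exact ⟨h.1, h.2, hce.2⟩
      refine le_trans ?_ hR
      rw [hL, tsum_cbinom_ind_eq, tsum_cbinom_ind_eq, switchCount_eq_of_cconn m hce.1 ∅,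
        ← Finset.bot_eq_empty, bot_symmDiff, symmDiff_bot, symmDiff_pair_eq]
    · refine le_of_eq_of_le (ENNReal.tsum_eq_zero.2 fun n => ?_) zero_le
      rw [hΦ]
      simp only
      rw [ind_of_false (fun h => hce h.2.2), mul_zero]
  -- removing the exit-edge constraint from the pair
  have pointwise2 : ∀ p : (edgesIn G Λ → ℕ) × (edgesIn G Λ → ℕ),
      w p.1 * w p.2 * Φ' (p.1 + p.2) p.2 ≤
        (ind (csources G Λ p.1 = {x} ∆ {z} ∧ 0 < p.1 e₀) * w p.1) *
          (ind (csources G Λ p.2 = {a} ∆ {x} ∧ CSupp G Λ (edgesIn G S) p.2) * w p.2) := by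
    intro p
    have hind : Φ' (p.1 + p.2) p.2 ≤ ind (csources G Λ p.1 = {x} ∆ {z} ∧ 0 < p.1 e₀) *
        ind (csources G Λ p.2 = {a} ∆ {x} ∧ CSupp G Λ (edgesIn G S) p.2) := by
      rw [hΦ', ← ind_and]
      simp only
      refine ind_mono fun ⟨h1, h2, e, hes, hpos⟩ => ⟨⟨?_, ?_⟩, h2⟩
      · rwa [hsub p] at h1
      · have hee : e = e₀ := Subtype.ext (by rw [hes])
        rw [hee] at hpos
        have h20 : p.2 e₀ = 0 := by
          by_contra hne
          exact hnotS (h2.2 e₀ hne)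
        simpa [h20] using hpos
    calc w p.1 * w p.2 * Φ' (p.1 + p.2) p.2
        ≤ w p.1 * w p.2 * (ind (csources G Λ p.1 = {x} ∆ {z} ∧ 0 < p.1 e₀) *
            ind (csources G Λ p.2 = {a} ∆ {x} ∧ CSupp G Λ (edgesIn G S) p.2)) :=
          mul_le_mul_right hind _
      _ = _ := by ring
  have htanh : Real.tanh (θ s(x, y)) = Real.tanh (θ e₀) := by rw [he₀]
  calc ∑' p, Ψ x y p
      = ∑' p : (edgesIn G Λ → ℕ) × (edgesIn G Λ → ℕ), w p.1 * w p.2 * Φ (p.1 + p.2) p.2 := by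
        refine tsum_congr fun p => ?_
        rw [hΨ, hΦ]
        simp only
        rw [hsub p]
    _ = ∑' m, w m * ∑' n, cbinom G Λ m n * Φ m n := tsum_pair_eq_tsum_cbinom_theta G Λ hθ Φ
    _ ≤ ∑' m, w m * ∑' n, cbinom G Λ m n * Φ' m n :=
        ENNReal.tsum_le_tsum fun m => mul_le_mul_right (inner m) _
    _ = ∑' p : (edgesIn G Λ → ℕ) × (edgesIn G Λ → ℕ), w p.1 * w p.2 * Φ' (p.1 + p.2) p.2 :=
        (tsum_pair_eq_tsum_cbinom_theta G Λ hθ Φ').symm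
    _ ≤ ∑' p : (edgesIn G Λ → ℕ) × (edgesIn G Λ → ℕ),
          (ind (csources G Λ p.1 = {x} ∆ {z} ∧ 0 < p.1 e₀) * w p.1) *
            (ind (csources G Λ p.2 = {a} ∆ {x} ∧ CSupp G Λ (edgesIn G S) p.2) * w p.2) :=
        ENNReal.tsum_le_tsum pointwise2
    _ = (∑' n, ind (csources G Λ n = {x} ∆ {z} ∧ 0 < n e₀) * w n) *
          gcurrentZ G Λ θ (edgesIn G S) ({a} ∆ {x}) := by
        rw [gcurrentZ, tsum_mul_tsum_eq_tsum_prod]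
    _ ≤ (ENNReal.ofReal (Real.tanh (θ e₀)) * ∑' n, ind (csources G Λ n = {y} ∆ {z}) * w n) *
          gcurrentZ G Λ θ (edgesIn G S) ({a} ∆ {x}) :=
        mul_le_mul_left (tsum_exit_edge_le_theta hθ z e₀ rfl) _
    _ = ENNReal.ofReal (Real.tanh (θ s(x, y))) * gcurrentZ G Λ θ (edgesIn G Λ) ({y} ∆ {z}) *
          gcurrentZ G Λ θ (edgesIn G S) ({a} ∆ {x}) := by
        rw [hZΛ, htanh]

end ThetaSimon

/-! ### The `+` boundary condition at zero field through the ghost graph -/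

section PlusGhost

variable {G : SimpleGraph V} [G.LocallyFinite] {Λ : Finset V}

/-- `∑_{e ∈ ∂ᵉΛ} σ_e = ∑_{x ∈ Λ} σ_x ∑_{y ∼ x, y ∉ Λ} σ_y`: every boundary bond has exactly one
endpoint in `Λ` (Friedli–Velenik 2017, §3.1, eq. (3.6) regrouped by the inner endpoint; the
tree's `IsingEffectiveField.sum_edgeBoundary_bondSpin`, restated here to keep the imports of this
file minimal). [cite: FriedliVelenik2017, §3.1, eq. (3.6)] -/
theorem sum_edgeBoundary_bondSpin_eq_sum_filter (Λ : Finset V) (σ : SpinConfig V) :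
    ∑ e ∈ edgeBoundary G Λ, bondSpin σ e =
      ∑ x ∈ Λ, spinAt x σ * ∑ y ∈ (G.neighborFinset x).filter (fun y => y ∉ Λ), spinAt y σ := by
  simp_rw [Finset.mul_sum]
  rw [Finset.sum_sigma']
  symm
  refine Finset.sum_bij (fun p _ => s(p.1, p.2)) ?_ ?_ ?_ ?_
  · rintro ⟨x, y⟩ hp
    rw [Finset.mem_sigma, mem_filter, SimpleGraph.mem_neighborFinset] at hp
    rw [mem_edgeBoundary_iff]
    exact ⟨(SimpleGraph.mem_edgeSet G).2 hp.2.1, ⟨x, hp.1, Sym2.mem_mk_left _ _⟩,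
      ⟨y, hp.2.2, Sym2.mem_mk_right _ _⟩⟩
  · rintro ⟨x, y⟩ hp ⟨x', y'⟩ hp' heq
    rw [Finset.mem_sigma, mem_filter] at hp hp'
    rcases Sym2.eq_iff.1 heq with ⟨rfl, rfl⟩ | ⟨rfl, rfl⟩
    · rfl
    · exact absurd hp'.1 hp.2.2
  · intro e he
    rw [mem_edgeBoundary_iff] at he
    obtain ⟨he, ⟨x, hx, hxe⟩, ⟨w, hw, hwe⟩⟩ := he
    have hxw : x ≠ w := fun h => hw (h ▸ hx)
    have hexw : e = s(x, w) := (Sym2.mem_and_mem_iff hxw).1 ⟨hxe, hwe⟩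
    refine ⟨⟨x, w⟩, ?_, hexw.symm⟩
    rw [Finset.mem_sigma, mem_filter, SimpleGraph.mem_neighborFinset]
    refine ⟨hx, ?_, hw⟩
    rw [hexw] at he
    exact he
  · rintro ⟨x, y⟩ _
    rfl

/-- **The `+`-boundary-condition Boltzmann weight at zero field as a product over the edges of
the ghost graph**: `e^{-βℋ⁺_Λ(σ)} = ∏_{e ∈ ℰ⁺_Λ} e^{θ_e σ⁺_e}` with the lifted configuration `σ⁺`
(`σ_g = +1`), `θ = β` on the edges of `G` inside `Λ` and `θ_{x,g} = β #{y ∼ x : y ∉ Λ}` on the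
ghost edges: the bonds to the frozen `+` spins act as a boundary field, realised as the coupling
to the ghost (Friedli–Velenik 2017, §3.8.1, p. 141: "`K_{{i}} = h + β #{j ∉ Λ : j ∼ i}`";
Aizenman–Duminil-Copin–Sidoravicius 2015, eq. (2.8): `J_{x,δ} = #{y ∉ Λ : y ∼ x}`). [cite: FriedliVelenik2017, §3.8.1, p. 141] -/
theorem isingWeight_plus_eq_prod_ghost {β : ℝ} {θ : Sym2 (Option V) → ℝ}
    (hθ₁ : ∀ e ∈ edgesIn G Λ, θ (liftEdge e) = β)
    (hθ₂ : ∀ x ∈ Λ, θ (ghostEdge x) = β * #((G.neighborFinset x).filter (fun y => y ∉ Λ)))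
    (τ : Λ → ℤˣ) :
    isingWeight G Λ β 0 .plus τ =
      ∏ e ∈ edgesIn (ghostGraph G Λ) (Finset.insertNone Λ),
        Real.exp (θ e * bondSpin (liftSpin (glue Λ τ .plus)) e) := by
  set σ := glue Λ τ .plus with hσ
  rw [← Real.exp_sum, sum_edgesIn_ghostGraph subset_rfl]
  unfold isingWeight
  congr 1
  have hE : interactionEdges G Λ (.plus : BoundaryCondition V) = edgesTouching G Λ := rfl
  rw [isingHamiltonian, hE, ← Finset.sum_sdiff (edgesIn_subset_edgesTouching (G := G) Λ),
    show edgesTouching G Λ \ edgesIn G Λ = edgeBoundary G Λ from rfl,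
    sum_edgeBoundary_bondSpin_eq_sum_filter Λ σ]
  have h1 : ∑ e ∈ edgesIn G Λ, θ (liftEdge e) * bondSpin (liftSpin σ) (liftEdge e) =
      β * ∑ e ∈ edgesIn G Λ, bondSpin σ e := by
    rw [mul_sum]
    exact sum_congr rfl fun e he => by rw [hθ₁ e he, bondSpin_liftSpin_liftEdge]
  have h2 : ∑ x ∈ Λ, θ (ghostEdge x) * bondSpin (liftSpin σ) (ghostEdge x) =
      β * ∑ x ∈ Λ, spinAt x σ * ∑ y ∈ (G.neighborFinset x).filter (fun y => y ∉ Λ), spinAt y σ := by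
    rw [mul_sum]
    refine sum_congr rfl fun x hx => ?_
    rw [hθ₂ x hx, bondSpin_liftSpin_ghostEdge]
    have hout : ∑ y ∈ (G.neighborFinset x).filter (fun y => y ∉ Λ), spinAt y σ =
        #((G.neighborFinset x).filter (fun y => y ∉ Λ)) := by
      rw [Finset.card_eq_sum_ones, Nat.cast_sum, Nat.cast_one]
      refine sum_congr rfl fun y hy => ?_
      rw [hσ, spinAt_glue_of_not_mem τ .plus (mem_filter.1 hy).2]
      simp [BoundaryCondition.plus, spinAt]
    rw [hout]
    ring
  rw [h1, h2]
  ring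

/-- **High-temperature expansion of the `+` Boltzmann weight at zero field**:
`e^{-βℋ⁺_Λ(σ)} = ∑_{F ⊆ ℰ⁺_Λ} (∏_{e∈F} sinh θ_e)(∏_{e ∈ ℰ⁺_Λ ∖ F} cosh θ_e) σ_{∂F ∖ {g}}`
(Duminil-Copin 2016, §2.2.1, the ghost edges carrying the boundary field). [cite: DuminilCopinECM2018, §2.2.1 (high-temperature expansion)] -/
theorem isingWeight_plus_eq_sum {β : ℝ} {θ : Sym2 (Option V) → ℝ}
    (hθ₁ : ∀ e ∈ edgesIn G Λ, θ (liftEdge e) = β)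
    (hθ₂ : ∀ x ∈ Λ, θ (ghostEdge x) = β * #((G.neighborFinset x).filter (fun y => y ∉ Λ)))
    (τ : Λ → ℤˣ) :
    isingWeight G Λ β 0 .plus τ =
      ∑ F ∈ (edgesIn (ghostGraph G Λ) (Finset.insertNone Λ)).powerset,
        ((∏ e ∈ F, Real.sinh (θ e)) *
            ∏ e ∈ edgesIn (ghostGraph G Λ) (Finset.insertNone Λ) \ F, Real.cosh (θ e)) *
          spinProduct (Finset.eraseNone (oddVerts (Finset.insertNone Λ) F)) (glue Λ τ .plus) := by
  rw [isingWeight_plus_eq_prod_ghost hθ₁ hθ₂]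
  simp_rw [exp_mul_bondSpin, add_comm (Real.cosh _)]
  rw [prod_add]
  refine sum_congr rfl fun F hF => ?_
  rw [prod_mul_distrib, prod_bondSpin_eq_spinProduct_oddVerts (ghostGraph G Λ) (mem_powerset.1 hF),
    spinProduct_liftSpin]
  ring

/-- **High-temperature expansion of the `+` Boltzmann sums at zero field**: for `A ⊆ Λ`,
`∑_τ e^{-βℋ⁺(τ)} σ_A(τ) = 2^{|Λ|} ∑_{F ⊆ ℰ⁺_Λ, ∂F = A*} (∏_{F} sinh θ_e)(∏_{ℰ⁺_Λ ∖ F} cosh θ_e)`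
(Duminil-Copin 2016, §2.2.1 with the `±1` symmetry trick; `A* = A` or `A ∪ {g}` according to
the parity of `|A|`). [cite: DuminilCopinECM2018, §2.2.1 (high-temperature expansion)] -/
theorem boltzmannSum_plus_eq {β : ℝ} {θ : Sym2 (Option V) → ℝ}
    (hθ₁ : ∀ e ∈ edgesIn G Λ, θ (liftEdge e) = β)
    (hθ₂ : ∀ x ∈ Λ, θ (ghostEdge x) = β * #((G.neighborFinset x).filter (fun y => y ∉ Λ)))
    {A : Finset V} (hA : A ⊆ Λ) :
    ∑ τ : Λ → ℤˣ, isingWeight G Λ β 0 .plus τ * spinProduct A (glue Λ τ .plus) =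
      Fintype.card (Λ → ℤˣ) *
        ∑ F ∈ (edgesIn (ghostGraph G Λ) (Finset.insertNone Λ)).powerset with
            oddVerts (Finset.insertNone Λ) F = starSet A,
          (∏ e ∈ F, Real.sinh (θ e)) *
            ∏ e ∈ edgesIn (ghostGraph G Λ) (Finset.insertNone Λ) \ F, Real.cosh (θ e) := by
  set E := edgesIn (ghostGraph G Λ) (Finset.insertNone Λ) with hE
  set c : Finset (Sym2 (Option V)) → ℝ := fun F =>
    (∏ e ∈ F, Real.sinh (θ e)) * ∏ e ∈ E \ F, Real.cosh (θ e) with hc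
  have hOsub : ∀ F ∈ E.powerset, Finset.eraseNone (oddVerts (Finset.insertNone Λ) F) ⊆ Λ := by
    intro F _ x hx
    rw [Finset.mem_eraseNone] at hx
    exact Finset.some_mem_insertNone.1 (oddVerts_subset _ _ hx)
  calc ∑ τ : Λ → ℤˣ, isingWeight G Λ β 0 .plus τ * spinProduct A (glue Λ τ .plus)
      = ∑ τ : Λ → ℤˣ, ∑ F ∈ E.powerset,
          c F * spinProduct (Finset.eraseNone (oddVerts (Finset.insertNone Λ) F) ∆ A) (glue Λ τ .plus) := by
        refine sum_congr rfl fun τ _ => ?_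
        rw [isingWeight_plus_eq_sum hθ₁ hθ₂, sum_mul]
        refine sum_congr rfl fun F _ => ?_
        rw [mul_assoc, spinProduct_mul_spinProduct]
    _ = ∑ F ∈ E.powerset, c F *
          if Finset.eraseNone (oddVerts (Finset.insertNone Λ) F) ∆ A = ∅ then (Fintype.card (Λ → ℤˣ) : ℝ) else 0 := by
        rw [sum_comm]
        refine sum_congr rfl fun F hF => ?_
        rw [← mul_sum, sum_spinProduct_glue (symmDiff_le_sup.trans (sup_le (hOsub F hF) hA))]
    _ = ∑ F ∈ E.powerset with oddVerts (Finset.insertNone Λ) F = starSet A, c F * Fintype.card (Λ → ℤˣ) := by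
        rw [sum_filter]
        refine sum_congr rfl fun F hF => ?_
        have heven : Even #(oddVerts (Finset.insertNone Λ) F) := even_card_oddVerts (mem_powerset.1 hF)
        by_cases hq : oddVerts (Finset.insertNone Λ) F = starSet A
        · rw [if_pos hq, if_pos]
          rw [Finset.symmDiff_eq_empty, (eraseNone_eq_iff_eq_starSet heven A).2 hq]
        · rw [if_neg hq, if_neg, mul_zero]
          intro h0
          exact hq ((eraseNone_eq_iff_eq_starSet heven A).1 (Finset.symmDiff_eq_empty.1 h0))
    _ = _ := by
        rw [mul_sum]
        exact sum_congr rfl fun F _ => by simp only [hc]; ring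

/-- **High-temperature expansion of the `+` correlations at zero field**: for `A ⊆ Λ`,
`⟨σ_A⟩⁺_{Λ;β,0} = g_{ℰ⁺_Λ}(A*) / g_{ℰ⁺_Λ}(∅)` with `g_E(B) = ∑_{F ⊆ E, ∂F = B} ∏_F tanh θ_e`
(Duminil-Copin 2016, §2.2.1, last display, the ghost edges carrying the boundary field of the
`+` boundary condition). [cite: DuminilCopinECM2018, §2.2.1 (high-temperature expansion)] -/
theorem isingCorr_plus_eq_ghteSum_div {β : ℝ} {θ : Sym2 (Option V) → ℝ}
    (hθ₁ : ∀ e ∈ edgesIn G Λ, θ (liftEdge e) = β)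
    (hθ₂ : ∀ x ∈ Λ, θ (ghostEdge x) = β * #((G.neighborFinset x).filter (fun y => y ∉ Λ)))
    {A : Finset V} (hA : A ⊆ Λ) :
    isingCorr G Λ β 0 .plus A =
      ghteSum (Finset.insertNone Λ) θ (edgesIn (ghostGraph G Λ) (Finset.insertNone Λ)) (starSet A) /
        ghteSum (Finset.insertNone Λ) θ (edgesIn (ghostGraph G Λ) (Finset.insertNone Λ)) ∅ := by
  have hZ : isingPartitionFunction G Λ β 0 .plus =
      ∑ τ : Λ → ℤˣ, isingWeight G Λ β 0 .plus τ * spinProduct ∅ (glue Λ τ .plus) := by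
    simp [isingPartitionFunction, spinProduct]
  rw [isingCorr, isingExpect, integral_isingMeasure G Λ β 0 .plus (measurable_spinProduct A), hZ,
    boltzmannSum_plus_eq hθ₁ hθ₂ hA, boltzmannSum_plus_eq hθ₁ hθ₂ (empty_subset Λ),
    sum_sinh_cosh_eq_cosh_mul_ghteSum, sum_sinh_cosh_eq_cosh_mul_ghteSum, starSet_empty]
  have hc : (Fintype.card (Λ → ℤˣ) : ℝ) *
      ∏ e ∈ edgesIn (ghostGraph G Λ) (Finset.insertNone Λ), Real.cosh (θ e) ≠ 0 :=
    (mul_pos (Nat.cast_pos.2 Fintype.card_pos) (prod_pos fun e _ => Real.cosh_pos _)).ne'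
  rw [← mul_assoc, ← mul_assoc, mul_div_mul_left _ _ hc]

/-- **The random-current representation of the `+` state at zero field** (Aizenman–Duminil-Copin–
Sidoravicius 2015, eqs. (2.7)–(2.8), through the ghost vertex `δ` with couplings
`J_{x,δ} = #{y ∉ Λ : y ∼ x}`; Duminil-Copin–Tassion 2016, eq. (2.2)): for `A ⊆ Λ` and couplings
`θ ≥ 0` equal to `β` on the edges of `G` inside `Λ` and to `β #{y ∼ x : y ∉ Λ}` on the ghost
edge at `x`, `⟨σ_A⟩⁺_{Λ;β,0} = Z_{ℰ⁺_Λ}(A*) / Z_{ℰ⁺_Λ}(∅)`, the currents living on the edges of the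
ghost graph inside `Λ ∪ {g}`. [cite: DuminilCopinTassionCMP2016, §2.3, eq. (2.2) (arXiv:1502.03050 numbering)] -/
theorem isingCorr_plus_eq_gcurrentZ_div {β : ℝ} {θ : Sym2 (Option V) → ℝ}
    (hθ : ∀ e, 0 ≤ θ e) (hθ₁ : ∀ e ∈ edgesIn G Λ, θ (liftEdge e) = β)
    (hθ₂ : ∀ x ∈ Λ, θ (ghostEdge x) = β * #((G.neighborFinset x).filter (fun y => y ∉ Λ)))
    {A : Finset V} (hA : A ⊆ Λ) :
    isingCorr G Λ β 0 .plus A =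
      (gcurrentZ (ghostGraph G Λ) (Finset.insertNone Λ) θ
          (edgesIn (ghostGraph G Λ) (Finset.insertNone Λ)) (starSet A)).toReal /
        (gcurrentZ (ghostGraph G Λ) (Finset.insertNone Λ) θ
          (edgesIn (ghostGraph G Λ) (Finset.insertNone Λ)) ∅).toReal := by
  rw [toReal_gcurrentZ_ghost subset_rfl hθ subset_rfl, toReal_gcurrentZ_ghost subset_rfl hθ subset_rfl,
    isingCorr_plus_eq_ghteSum_div hθ₁ hθ₂ hA,
    mul_div_mul_left _ _ (prod_pos fun e _ => Real.cosh_pos _).ne']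

end PlusGhost

/-! ### The modified Simon inequality with `+` boundary condition, finite volume -/

section PlusSimon

variable {G : SimpleGraph V} [G.LocallyFinite] {Λ : Finset V}

/-- The edges of the ghost graph inside a set `S` of real vertices are the lifted edges of `G`
inside `S` (no ghost edge has both endpoints real; the tree's
`MeanFieldDifferentialInequality.edgesIn_ghostGraph_map_some`, restated to keep the imports of
this file minimal). [folklore] -/
theorem edgesIn_ghostGraph_mapSome_eq (S : Finset V) :
    edgesIn (ghostGraph G Λ) (S.map Function.Embedding.some) = (edgesIn G S).map liftEdge := by
  ext e
  rw [mem_edgesIn_iff, Finset.mem_map]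
  induction e using Sym2.ind with
  | _ a b =>
    rcases a with _ | x <;> rcases b with _ | y
    · simp only [SimpleGraph.mem_edgeSet, ghostGraph_adj_none_none, false_and, false_iff,
        not_exists, not_and]
      exact fun e _ h => none_not_mem_liftEdge e (h.symm ▸ Sym2.mem_mk_left _ _)
    · constructor
      · rintro ⟨-, hmem⟩
        have := hmem none (Sym2.mem_mk_left _ _)
        simp at this
      · rintro ⟨e, -, he⟩
        exact absurd (he ▸ Sym2.mem_mk_left _ _) (none_not_mem_liftEdge e)
    · constructor
      · rintro ⟨-, hmem⟩
        have := hmem none (Sym2.mem_mk_right _ _)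
        simp at this
      · rintro ⟨e, -, he⟩
        exact absurd (he ▸ Sym2.mem_mk_right _ _) (none_not_mem_liftEdge e)
    · constructor
      · rintro ⟨hadj, hmem⟩
        refine ⟨s(x, y), mem_edgesIn_iff.2 ⟨?_, fun v hv => ?_⟩, rfl⟩
        · exact (SimpleGraph.mem_edgeSet G).2
            (ghostGraph_adj_some_some.1 ((SimpleGraph.mem_edgeSet _).1 hadj))
        · rcases Sym2.mem_iff.1 hv with rfl | rfl
          · simpa using hmem (some v) (Sym2.mem_mk_left _ _)
          · simpa using hmem (some v) (Sym2.mem_mk_right _ _)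
      · rintro ⟨e, he, hexy⟩
        induction e using Sym2.ind with
        | _ u w =>
          rw [liftEdge_mk] at hexy
          obtain ⟨hadj, hmem⟩ := mem_edgesIn_iff.1 he
          have hadj' : G.Adj u w := (SimpleGraph.mem_edgeSet G).1 hadj
          refine ⟨?_, fun v hv => ?_⟩
          · rw [← hexy]
            exact (SimpleGraph.mem_edgeSet _).2 (ghostGraph_adj_some_some.2 hadj')
          · rw [← hexy] at hv
            rcases Sym2.mem_iff.1 hv with rfl | rfl
            · simpa using hmem u (Sym2.mem_mk_left u w)
            · simpa using hmem w (Sym2.mem_mk_right u w)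

omit [G.LocallyFinite] in
/-- The neighbours of a real vertex `x ∈ Λ` in `(Λ ∪ {g}) ∖ S`, for the ghost graph: the
neighbours of `x` in `Λ ∖ S` together with the ghost. [folklore] -/
theorem filter_ghostAdj_some_eq_insertNone [DecidableRel G.Adj] (S : Finset V) {x : V} (hx : x ∈ Λ) :
    (Finset.insertNone Λ \ S.map Function.Embedding.some).filter ((ghostGraph G Λ).Adj (some x)) =
      Finset.insertNone ((Λ \ S).filter (G.Adj x)) := by
  ext o
  rcases o with _ | y
  · simp [hx]
  · simp [Finset.mem_insertNone]

omit [DecidableEq V] in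
/-- A set of real vertices lies inside `S ∪ {g}`. [folklore] -/
theorem map_some_subset_insertNone (S : Finset V) :
    S.map Function.Embedding.some ⊆ Finset.insertNone S := by
  intro o ho
  obtain ⟨s, hs, rfl⟩ := Finset.mem_map.1 ho
  exact Finset.some_mem_insertNone.2 hs

/-- `|{u} ∆ {v}|` is even (`0` or `2`). [folklore] -/
theorem even_card_symmDiff_singletons (u v : V) : Even #(({u} ∆ {v} : Finset V)) := by
  by_cases h : u = v
  · subst h
    simp
  · rw [← pair_eq_symmDiff (Ne.symm h), card_pair (Ne.symm h)]
    exact even_two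

/-- `{u} ∆ {v}` lifted to the ghost vertex type. [folklore] -/
theorem map_some_singleton_symmDiff (u v : V) :
    (({u} ∆ {v} : Finset V)).map Function.Embedding.some = ({some u} ∆ {some v} : Finset (Option V)) := by
  rw [Finset.map_eq_image, Finset.image_symmDiff _ _ Function.Embedding.some.injective,
    image_singleton, image_singleton]
  rfl

variable [DecidableRel G.Adj]

/-- **The modified Simon inequality with `+` boundary condition, in finite volume**
(Duminil-Copin–Tassion 2016, the finite-volume display of the proof of Lemma 2.7, here for the
`+` state at zero field instead of the free state with field `h > 0`): for the nearest-neighbour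
Ising model on a locally finite graph `G` (coupling `1` on every edge), `β ≥ 0`, finite `S ⊆ Λ`
such that every neighbour of `S` lies in `Λ`, `a ∈ S` and `z ∈ Λ ∖ S`,
`⟨σ_aσ_z⟩⁺_{Λ;β,0} ≤ ∑_{x ∈ S} ∑_{y ∈ Λ∖S, y ∼ x} tanh β · ⟨σ_aσ_x⟩^∅_{S;β,0} · ⟨σ_yσ_z⟩⁺_{Λ;β,0}`.
Proof: the `+` state of `Λ` is the free state of the ghost graph on `Λ ∪ {g}` with couplings
`β` inside `Λ` and `β #{y ∼ x : y ∉ Λ}` on the ghost edges (`isingCorr_plus_eq_gcurrentZ_div`);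
apply the current inequality `gcurrentZ_mul_gcurrentZ_le` there with the real set `S ∌ g`: the
exit through the ghost edge at `x ∈ S` costs `tanh(β · 0) = 0` since `x` has no neighbour
outside `Λ`, and the currents inside `S` only use edges of `G`, giving `⟨σ_aσ_x⟩^∅_{S;β,0}`. [cite: DuminilCopinTassionCMP2016, Lemma 2.7 and its proof, §2.5 (arXiv:1502.03050 numbering)] -/
theorem isingTwoPoint_plus_le_modifiedSimon {β : ℝ} (hβ : 0 ≤ β) {S : Finset V}
    (hSΛ : S ⊆ Λ) (hnb : ∀ x ∈ S, ∀ y, G.Adj x y → y ∈ Λ) {a z : V} (ha : a ∈ S) (hz : z ∈ Λ)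
    (hzS : z ∉ S) :
    isingTwoPoint G Λ β 0 .plus a z ≤
      ∑ x ∈ S, ∑ y ∈ (Λ \ S).filter (G.Adj x),
        Real.tanh β * isingTwoPoint G S β 0 .free a x * isingTwoPoint G Λ β 0 .plus y z := by
  classical
  -- the couplings realising the `+` boundary condition on the ghost graph
  obtain ⟨θ, hθ, hθ₁, hθ₂⟩ : ∃ θ : Sym2 (Option V) → ℝ, (∀ e, 0 ≤ θ e) ∧
      (∀ e ∈ edgesIn G Λ, θ (liftEdge e) = β) ∧
      (∀ x ∈ Λ, θ (ghostEdge x) = β * #((G.neighborFinset x).filter (fun y => y ∉ Λ))) := by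
    refine ⟨Sym2.lift ⟨fun u v => u.elim (v.elim 0 fun y => β * #((G.neighborFinset y).filter (fun w => w ∉ Λ)))
      fun x => v.elim (β * #((G.neighborFinset x).filter (fun w => w ∉ Λ))) fun _ => β, ?_⟩, ?_, ?_, ?_⟩
    · rintro (_ | x) (_ | y) <;> rfl
    · intro e
      induction e using Sym2.ind with
      | _ u v =>
        rcases u with _ | x <;> rcases v with _ | y
        · exact le_rfl
        · exact mul_nonneg hβ (Nat.cast_nonneg _)
        · exact mul_nonneg hβ (Nat.cast_nonneg _)
        · exact hβ
    · intro e _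
      induction e using Sym2.ind with
      | _ u v => rfl
    · intro x _
      rfl
  -- the ghost term at a vertex of `S` vanishes
  have hout : ∀ x ∈ S, (G.neighborFinset x).filter (fun y => y ∉ Λ) = ∅ := by
    intro x hx
    refine filter_eq_empty_iff.2 fun y hy hyΛ => hyΛ (hnb x hx y ?_)
    exact (SimpleGraph.mem_neighborFinset _ _ _).1 hy
  have hghost : ∀ x ∈ S, θ s(some x, none) = 0 := by
    intro x hx
    have := hθ₂ x (hSΛ hx)
    rw [ghostEdge_apply, hout x hx, card_empty, Nat.cast_zero, mul_zero] at this
    exact this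
  have hlift : ∀ x ∈ Λ, ∀ y ∈ Λ, G.Adj x y → θ s(some x, some y) = β := by
    intro x hx y hy hxy
    rw [← liftEdge_mk]
    refine hθ₁ _ (mem_edgesIn_iff.2 ⟨(SimpleGraph.mem_edgeSet G).2 hxy, fun v hv => ?_⟩)
    rcases Sym2.mem_iff.1 hv with rfl | rfl
    · exact hx
    · exact hy
  -- the sets on the ghost graph
  have hS' : S.map Function.Embedding.some ⊆ Finset.insertNone Λ :=
    (map_some_subset_insertNone S).trans (Finset.insertNone.monotone hSΛ)
  have ha' : some a ∈ S.map Function.Embedding.some := by simpa using ha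
  have hzS' : some z ∉ S.map Function.Embedding.some := by simpa using hzS
  have hES : edgesIn (ghostGraph G Λ) (S.map Function.Embedding.some) ⊆
      edgesIn (ghostGraph G Λ) (Finset.insertNone Λ) := edgesIn_mono _ hS'
  have hfinΛ : ∀ B, gcurrentZ (ghostGraph G Λ) (Finset.insertNone Λ) θ
      (edgesIn (ghostGraph G Λ) (Finset.insertNone Λ)) B ≠ ∞ :=
    fun B => gcurrentZ_ne_top hθ subset_rfl B
  have hfinS : ∀ B, gcurrentZ (ghostGraph G Λ) (Finset.insertNone Λ) θ
      (edgesIn (ghostGraph G Λ) (S.map Function.Embedding.some)) B ≠ ∞ :=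
    fun B => gcurrentZ_ne_top hθ hES B
  -- the current inequality on the ghost graph, reindexed over real vertices
  have key := gcurrentZ_mul_gcurrentZ_le (ghostGraph G Λ) (Finset.insertNone Λ) hθ hS' ha' hzS'
  have key' : gcurrentZ (ghostGraph G Λ) (Finset.insertNone Λ) θ
        (edgesIn (ghostGraph G Λ) (Finset.insertNone Λ)) ({some a} ∆ {some z}) *
      gcurrentZ (ghostGraph G Λ) (Finset.insertNone Λ) θ
        (edgesIn (ghostGraph G Λ) (S.map Function.Embedding.some)) ∅ ≤
      ∑ x ∈ S, ∑ y ∈ (Λ \ S).filter (G.Adj x),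
        ENNReal.ofReal (Real.tanh β) *
          gcurrentZ (ghostGraph G Λ) (Finset.insertNone Λ) θ
            (edgesIn (ghostGraph G Λ) (Finset.insertNone Λ)) ({some y} ∆ {some z}) *
          gcurrentZ (ghostGraph G Λ) (Finset.insertNone Λ) θ
            (edgesIn (ghostGraph G Λ) (S.map Function.Embedding.some)) ({some a} ∆ {some x}) := by
    refine key.trans (le_of_eq ?_)
    rw [sum_map]
    refine sum_congr rfl fun x hx => ?_
    rw [Function.Embedding.some_apply, filter_ghostAdj_some_eq_insertNone S (hSΛ hx),
      Finset.sum_insertNone, hghost x hx, Real.tanh_zero, ENNReal.ofReal_zero, zero_mul, zero_mul,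
      zero_add]
    refine sum_congr rfl fun y hy => ?_
    obtain ⟨hyΛS, hxy⟩ := mem_filter.1 hy
    rw [hlift x (hSΛ hx) y (mem_sdiff.1 hyΛS).1 hxy]
  -- in real numbers
  have htanh : 0 ≤ Real.tanh β := tanh_nonneg hβ
  have keyR : (gcurrentZ (ghostGraph G Λ) (Finset.insertNone Λ) θ
        (edgesIn (ghostGraph G Λ) (Finset.insertNone Λ)) ({some a} ∆ {some z})).toReal *
      (gcurrentZ (ghostGraph G Λ) (Finset.insertNone Λ) θ
        (edgesIn (ghostGraph G Λ) (S.map Function.Embedding.some)) ∅).toReal ≤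
      ∑ x ∈ S, ∑ y ∈ (Λ \ S).filter (G.Adj x),
        Real.tanh β *
          (gcurrentZ (ghostGraph G Λ) (Finset.insertNone Λ) θ
            (edgesIn (ghostGraph G Λ) (Finset.insertNone Λ)) ({some y} ∆ {some z})).toReal *
          (gcurrentZ (ghostGraph G Λ) (Finset.insertNone Λ) θ
            (edgesIn (ghostGraph G Λ) (S.map Function.Embedding.some)) ({some a} ∆ {some x})).toReal := by
    have hne : ∀ x ∈ S, ∀ y ∈ (Λ \ S).filter (G.Adj x),
        ENNReal.ofReal (Real.tanh β) *
          gcurrentZ (ghostGraph G Λ) (Finset.insertNone Λ) θ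
            (edgesIn (ghostGraph G Λ) (Finset.insertNone Λ)) ({some y} ∆ {some z}) *
          gcurrentZ (ghostGraph G Λ) (Finset.insertNone Λ) θ
            (edgesIn (ghostGraph G Λ) (S.map Function.Embedding.some)) ({some a} ∆ {some x}) ≠ ∞ :=
      fun x _ y _ => ENNReal.mul_ne_top (ENNReal.mul_ne_top ENNReal.ofReal_ne_top (hfinΛ _)) (hfinS _)
    have h := ENNReal.toReal_mono (ENNReal.sum_ne_top.2 fun x hx => ENNReal.sum_ne_top.2 (hne x hx)) key'
    rw [ENNReal.toReal_mul, ENNReal.toReal_sum (fun x hx => ENNReal.sum_ne_top.2 (hne x hx))] at h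
    refine h.trans (le_of_eq (sum_congr rfl fun x hx => ?_))
    rw [ENNReal.toReal_sum (hne x hx)]
    refine sum_congr rfl fun y _ => ?_
    rw [ENNReal.toReal_mul, ENNReal.toReal_mul, ENNReal.toReal_ofReal htanh]
  -- the representations
  have h2pt : ∀ (T : Finset V) (bc : BoundaryCondition V) (u v : V),
      isingTwoPoint G T β 0 bc u v = isingCorr G T β 0 bc ({u} ∆ {v}) := fun T bc u v => by
    simp only [isingTwoPoint, isingCorr, spinPair_eq_spinProduct_symmDiff]
  have hrepΛ : ∀ u ∈ Λ, ∀ v ∈ Λ, isingTwoPoint G Λ β 0 .plus u v =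
      (gcurrentZ (ghostGraph G Λ) (Finset.insertNone Λ) θ
          (edgesIn (ghostGraph G Λ) (Finset.insertNone Λ)) ({some u} ∆ {some v})).toReal /
        (gcurrentZ (ghostGraph G Λ) (Finset.insertNone Λ) θ
          (edgesIn (ghostGraph G Λ) (Finset.insertNone Λ)) ∅).toReal := by
    intro u hu v hv
    have hA : ({u} ∆ {v} : Finset V) ⊆ Λ :=
      symmDiff_le_sup.trans (sup_le (singleton_subset_iff.2 hu) (singleton_subset_iff.2 hv))
    rw [h2pt, isingCorr_plus_eq_gcurrentZ_div hθ hθ₁ hθ₂ hA,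
      starSet_of_even (even_card_symmDiff_singletons u v), map_some_singleton_symmDiff]
  have hrepS : ∀ x ∈ S, isingTwoPoint G S β 0 .free a x =
      (gcurrentZ (ghostGraph G Λ) (Finset.insertNone Λ) θ
          (edgesIn (ghostGraph G Λ) (S.map Function.Embedding.some)) ({some a} ∆ {some x})).toReal /
        (gcurrentZ (ghostGraph G Λ) (Finset.insertNone Λ) θ
          (edgesIn (ghostGraph G Λ) (S.map Function.Embedding.some)) ∅).toReal := by
    intro x hx
    have hA : ({a} ∆ {x} : Finset V) ⊆ S :=
      symmDiff_le_sup.trans (sup_le (singleton_subset_iff.2 ha) (singleton_subset_iff.2 hx))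
    have hcong : ∀ B, gcurrentZ (ghostGraph G Λ) (Finset.insertNone Λ) (ghostCoupling β 0)
        ((edgesIn G S).map liftEdge) B =
        gcurrentZ (ghostGraph G Λ) (Finset.insertNone Λ) θ
          (edgesIn (ghostGraph G Λ) (S.map Function.Embedding.some)) B := by
      intro B
      rw [edgesIn_ghostGraph_mapSome_eq]
      refine gcurrentZ_congr (fun e he => ?_) B
      obtain ⟨e', he', rfl⟩ := Finset.mem_map.1 he
      rw [ghostCoupling_liftEdge, hθ₁ e' (edgesIn_mono G hSΛ he')]
    rw [h2pt,
      isingCorr_free_zero_eq_gcurrentZ_div hSΛ hβ 0 hA (even_card_symmDiff_singletons a x),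
      map_some_singleton_symmDiff, hcong, hcong]
  -- positivity of the normalisations
  have hZΛpos : 0 < (gcurrentZ (ghostGraph G Λ) (Finset.insertNone Λ) θ
      (edgesIn (ghostGraph G Λ) (Finset.insertNone Λ)) ∅).toReal :=
    toReal_gcurrentZ_ghost_empty_pos subset_rfl hθ subset_rfl
  have hZSpos : 0 < (gcurrentZ (ghostGraph G Λ) (Finset.insertNone Λ) θ
      (edgesIn (ghostGraph G Λ) (S.map Function.Embedding.some)) ∅).toReal :=
    toReal_gcurrentZ_ghost_empty_pos hSΛ hθ (edgesIn_mono _ (map_some_subset_insertNone S))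
  -- assemble
  rw [hrepΛ a (hSΛ ha) z hz]
  have hRHS : ∑ x ∈ S, ∑ y ∈ (Λ \ S).filter (G.Adj x),
      Real.tanh β * isingTwoPoint G S β 0 .free a x * isingTwoPoint G Λ β 0 .plus y z =
      (∑ x ∈ S, ∑ y ∈ (Λ \ S).filter (G.Adj x),
        Real.tanh β *
          (gcurrentZ (ghostGraph G Λ) (Finset.insertNone Λ) θ
            (edgesIn (ghostGraph G Λ) (Finset.insertNone Λ)) ({some y} ∆ {some z})).toReal *
          (gcurrentZ (ghostGraph G Λ) (Finset.insertNone Λ) θ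
            (edgesIn (ghostGraph G Λ) (S.map Function.Embedding.some)) ({some a} ∆ {some x})).toReal) /
        ((gcurrentZ (ghostGraph G Λ) (Finset.insertNone Λ) θ
            (edgesIn (ghostGraph G Λ) (Finset.insertNone Λ)) ∅).toReal *
          (gcurrentZ (ghostGraph G Λ) (Finset.insertNone Λ) θ
            (edgesIn (ghostGraph G Λ) (S.map Function.Embedding.some)) ∅).toReal) := by
    rw [sum_div]
    refine sum_congr rfl fun x hx => ?_
    rw [sum_div]
    refine sum_congr rfl fun y hy => ?_
    have hyΛ : y ∈ Λ := (mem_sdiff.1 (mem_filter.1 hy).1).1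
    rw [hrepS x hx, hrepΛ y hyΛ z hz]
    field_simp
  rw [hRHS, div_le_div_iff₀ hZΛpos (mul_pos hZΛpos hZSpos)]
  calc _ = ((gcurrentZ (ghostGraph G Λ) (Finset.insertNone Λ) θ
            (edgesIn (ghostGraph G Λ) (Finset.insertNone Λ)) ({some a} ∆ {some z})).toReal *
          (gcurrentZ (ghostGraph G Λ) (Finset.insertNone Λ) θ
            (edgesIn (ghostGraph G Λ) (S.map Function.Embedding.some)) ∅).toReal) *
          (gcurrentZ (ghostGraph G Λ) (Finset.insertNone Λ) θ
            (edgesIn (ghostGraph G Λ) (Finset.insertNone Λ)) ∅).toReal := by ring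
    _ ≤ _ := mul_le_mul_of_nonneg_right keyR hZΛpos.le

end PlusSimon

end Literature.Probability.LatticeModels


/-! ### Lemma 2.7 for the plus state on `ℤ^d` -/

namespace Literature.Probability.LatticeModels

variable {d : ℕ}

/-- **Duminil-Copin–Tassion 2016, Lemma 2.7 (modified Simon's inequality) for the plus state —
the named fact `dct_modifiedSimon` discharged**: for the nearest-neighbour Ising model on `ℤ^d`,
`β > 0`, a finite `S ∋ 0` and `z ∉ S`,
`⟨σ₀σ_z⟩⁺_β ≤ ∑_{x ∈ S} ∑_{y ∉ S, y ∼ x} tanh β · ⟨σ₀σ_x⟩_{S,β,0} · ⟨σ_yσ_z⟩⁺_β`.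
Proof: the finite-volume inequality with `+` boundary condition at zero field
(`isingTwoPoint_plus_le_modifiedSimon`) in the boxes `Λ_L ⊇ S ∪ ∂S ∪ {z}`, and `L → ∞` through the
existence of the plus state on pair observables (`tendsto_isingExpect_plus_spinPair`,
`hasBoxLimit_isingCorr_plus_holds`); the source lets `Λ ↑ V` at `h > 0` and then `h ↘ 0`
(arXiv:1502.03050, p. 20), the tree's `⟨·⟩⁺_{β,0}` being the box limit of the `+` states at
`h = 0`. [cite: DuminilCopinTassionCMP2016, Lemma 2.7 (modified Simon's inequality) and its proof, §2.5 (arXiv:1502.03050 numbering)] -/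
theorem dct_modifiedSimon_holds : dct_modifiedSimon (d := d) := by
  intro β hβ S h0 z hzS
  -- a finite set whose inclusion in the box makes the finite-volume inequality available
  set T : Finset (Site d) := insert z (S ∪ S.biUnion fun x => (zdGraph d).neighborFinset x) with hT
  have hlimL : Tendsto (fun L : ℕ => isingExpect (zdGraph d) (box d L) β 0 .plus (spinPair 0 z))
      atTop (𝓝 (plusPair d β 0 z)) :=
    tendsto_isingExpect_plus_spinPair hasBoxLimit_isingCorr_plus_holds hβ.le 0 z
  have hlimR : Tendsto (fun L : ℕ => ∑ x ∈ S,
      ∑ y ∈ ((zdGraph d).neighborFinset x).filter (fun y => y ∉ S),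
        Real.tanh β * isingTwoPoint (zdGraph d) S β 0 .free 0 x *
          isingExpect (zdGraph d) (box d L) β 0 .plus (spinPair y z)) atTop
      (𝓝 (∑ x ∈ S, ∑ y ∈ ((zdGraph d).neighborFinset x).filter (fun y => y ∉ S),
        Real.tanh β * isingTwoPoint (zdGraph d) S β 0 .free 0 x * plusPair d β y z)) :=
    tendsto_finsetSum _ fun x _ => tendsto_finsetSum _ fun y _ =>
      (tendsto_isingExpect_plus_spinPair hasBoxLimit_isingCorr_plus_holds hβ.le y z).const_mul _
  refine le_of_tendsto_of_tendsto hlimL hlimR ?_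
  filter_upwards [eventually_subset_box' T] with L hL
  have hzL : z ∈ box d L := hL (by rw [hT]; exact mem_insert_self _ _)
  have hSL : S ⊆ box d L := fun x hx =>
    hL (by rw [hT]; exact mem_insert_of_mem (mem_union_left _ hx))
  have hnb : ∀ x ∈ S, ∀ y, (zdGraph d).Adj x y → y ∈ box d L := by
    intro x hx y hxy
    refine hL ?_
    rw [hT, mem_insert, mem_union, mem_biUnion]
    exact Or.inr (Or.inr ⟨x, hx, (SimpleGraph.mem_neighborFinset _ _ _).2 hxy⟩)
  have h := isingTwoPoint_plus_le_modifiedSimon (G := zdGraph d) hβ.le hSL hnb h0 hzL hzS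
  have hidx : ∀ x ∈ S, (box d L \ S).filter ((zdGraph d).Adj x) =
      ((zdGraph d).neighborFinset x).filter (fun y => y ∉ S) := by
    intro x hx
    ext y
    simp only [Finset.mem_filter, Finset.mem_sdiff, SimpleGraph.mem_neighborFinset]
    constructor
    · rintro ⟨⟨-, hyS⟩, hxy⟩
      exact ⟨hxy, hyS⟩
    · rintro ⟨hxy, hyS⟩
      exact ⟨⟨hnb x hx y hxy, hyS⟩, hxy⟩
  calc isingExpect (zdGraph d) (box d L) β 0 .plus (spinPair 0 z)
      = isingTwoPoint (zdGraph d) (box d L) β 0 .plus 0 z := rfl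
    _ ≤ _ := h
    _ = _ := sum_congr rfl fun x hx => by rw [hidx x hx]; rfl

end Literature.Probability.LatticeModels
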